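import Literature.NumberTheory.Automorphic.BookerKrishnamurthyConverseProofs
import Literature.NumberTheory.GaloisRepresentations.KummerKeyStep
import Literature.NumberTheory.GaloisRepresentations.HeckeCharacterNormOneProofs
import Literature.NumberTheory.GaloisRepresentations.HeckeCharacterNormTwistProofs
import Literature.NumberTheory.GaloisRepresentations.ArtinLFunctionContinuationFE
import HarnessLib

/-!
# Booker–Krishnamurthy over `ℚ`: the hypothesis of Cor. 1.2 is "`Λ(s, σ)` is entire"

Companion of `Automorphic/BookerKrishnamurthyConverse` (the named fact
`bookerKrishnamurthy_isPiOfArtinRep_of_entire_twists`: Booker–Krishnamurthy, *A strengthening of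
the GL(2) converse theorem*, Compositio Math. 147 (2011), Cor. 1.2, p. 670, for Galois
representations) and of `Automorphic/BookerKrishnamurthyConverseProofs`. The hypothesis of the
fact quantifies over all unitary idèle class characters `ω` of `F` unramified at every finite
place. Op. cit. p. 671: "while there are no non-trivial unramified idèle class characters over
`ℚ`, there are infinitely many such characters over a number field; thus, unlike the result of
[Boo03], it does not seem possible in general (by these methods) to deduce automorphy from
analytic properties of a single `L`-function" — i.e. over `F = ℚ` the only such `ω` are the
`‖·‖_𝔸^{it}`, `t ∈ ℝ` ("non-trivial" = modulo these), whose twists merely translate `Λ(s, σ)`.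
This file PROVES that reduction over the tree's carriers:

* `HeckeCharacter.isNormTwist_of_forall_isUnramifiedAt_rat` — **every idèle class character of
  `ℚ` unramified at all finite places is a norm twist `‖·‖^z`** (`𝕀_ℚ = ℚˣ · (ℝ_{>0} × ∏_p ℤ_pˣ)`,
  Neukirch VI (1.10), in the tree as `Rat.unitIdele`; the character kills `ℚˣ`, kills
  `∏_p ℤ_pˣ` by unramifiedness (`HeckeCharacter.eq_one_of_isUnramifiedAt_of_units`), and on
  `ℝ_{>0}` it is `r ↦ r^z` (`exists_cpow_of_continuous_isReal`), while `‖x‖ = r`); with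
  `IsUnitary.exists_eq_cpow_mul_I` a unitary one is `‖·‖^{it}`;
* `artinTwistCompletedL_eq_comp_add_rat` — for such `ω = ‖·‖^{it}` and any parameter family
  `P` of `ω`, `Λ(s, σ ⊗ ω) = Λ₀(s + it)` with `Λ₀(s) = γ(σ, s) L(σ, s)`
  (`ω_∞ = |·|^{it}`, `ω_p(p) = p^{-it}`);
* `bookerKrishnamurthy_hypothesis_iff_rat` — hence, for an Artin representation `σ` of `ℚ`, the
  hypothesis "`Λ(s, σ ⊗ ω)` entire for every unitary everywhere-unramified `ω`" of the named fact
  is EQUIVALENT to "`γ(σ, s) L(σ, s)` has an entire continuation";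
* `LFunction.hasEntireContinuation_completedArtinLFunction_iff` — `Λ(ρ, s) = A(ρ)^{s/2} γ(ρ, s)
  L(ρ, s)` (the tree's `completedArtinLFunction`, with the conductor power) has an entire
  continuation iff `γ(ρ, s) L(ρ, s)` has one (`A(ρ) ≠ 0`, `ArtinRep.artinConductorNorm_ne_zero'`,
  so `A(ρ)^{±s/2}` is entire), for any number field;
* `bookerKrishnamurthy_isPiOfArtinRep_of_entire_twists.rat` (and `.rat'` with the hypothesis on
  `completedArtinLFunction`) — the `F = ℚ` instance of the named fact in that form: **if `Λ(s, σ) = γ(σ, s) L(σ, s)` is entire then `σ : Γ_ℚ → GL₂(ℂ)` is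
  automorphic** (`∃ π, IsPiOfArtinRep σ π`), for every `σ` (either parity, not assumed
  irreducible) — the statement "one recovers Booker 2003" of the fact's docstring, as a
  consequence of the fact (cf. `Automorphic/BookerStrongArtin`, which vendors Booker's 2003
  Corollary itself, for irreducible `σ`, with the finite `L`-function and a cuspidal `π`).

No definition and no named fact is introduced.

## References

* A. R. Booker, M. Krishnamurthy, Compositio Math. 147 (2011), Cor. 1.2 (p. 670), p. 671.
  [BookerKrishnamurthy2011]
* A. R. Booker, Ann. of Math. 158 (2003), Corollary p. 1090. [Booker2003]
* J. Neukirch, *Algebraic Number Theory* (1999), Ch. VI §1, Prop. (1.10) (`I_ℚ`). [NeukirchANT1999]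
* J. Tate, thesis (1950), §4.3 (quasi-characters trivial on `𝕀¹` are `|·|^s`). [TateThesis1967]
-/

noncomputable section

open scoped NumberField Classical
open NumberField NumberField.InfinitePlace IsDedekindDomain Complex
open Literature.NumberTheory.GaloisRepresentations

namespace Literature.NumberTheory.Automorphic

universe u

/-! ### Norm twists: values at uniformizers and the twisted Euler factors -/

section NormTwist

variable {K : Type u} [Field K] [NumberField K]

/-- The `v`-adic norm of the chosen uniformizer is `q_v⁻¹` (local copy of
`HeckeCharacter.norm_uniformizer` of `GaloisRepresentations/HeckeLFunctionNonvanishingLineProofs`,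
stated with `residueCard`, not imported to keep this file's imports off the Hecke `L`-function
cone). [folklore] -/
private theorem norm_uniformizer' (v : HeightOneSpectrum (𝓞 K)) :
    ‖(HeckeCharacter.uniformizer K v : v.adicCompletion K)‖ = (v.residueCard : ℝ)⁻¹ := by
  rw [FinitePlace.norm_def, HeckeCharacter.valued_uniformizer, WithZero.exp,
    WithZeroMulInt.toNNReal_neg_apply _ WithZero.coe_ne_zero, WithZero.unzero_coe, toAdd_ofAdd,
    zpow_neg, zpow_one, NNReal.coe_inv, NNReal.coe_natCast]
  rfl

/-- **A norm twist `‖·‖^z` takes the value `q_v^{-z}` at (a uniformizer of) `v`**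
(`‖ϖ_v‖_𝔸 = q_v⁻¹`, `ideleNorm_localUnits`); local copy of
`HeckeCharacter.valueAtUniformizer_of_forall_apply_eq_cpow` of
`GaloisRepresentations/HeckeLFunctionNonvanishingLineProofs` (same remark as for
`norm_uniformizer'`). Tate's thesis §2.3/§4.3. [cite: TateThesis1967, §4.3] -/
private theorem valueAtUniformizer_of_eq_cpow_ideleNorm {ω : HeckeCharacter K} {z : ℂ}
    (hz : ∀ x : ideleGroup K, (ω x : ℂ) = (ideleNorm x : ℂ) ^ z)
    (v : HeightOneSpectrum (𝓞 K)) :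
    ω.valueAtUniformizer v = ((v.residueCard : ℂ) ^ z)⁻¹ := by
  rw [HeckeCharacter.valueAtUniformizer, HeckeCharacter.localComponent_apply, hz,
    ideleNorm_localUnits, norm_uniformizer', Complex.ofReal_inv, Complex.ofReal_natCast,
    Complex.inv_cpow _ _ (by rw [Complex.natCast_arg]; exact Real.pi_ne_zero.symm)]

/-- For a norm twist `ω = ‖·‖^z` the twisted Euler point `ω_v(ϖ_v) q_v^{-s}` is `q_v^{-(s+z)}`:
twisting by `‖·‖^z` translates the Euler product. [cite: TateThesis1967, §4.3] -/
theorem valueAtUniformizer_mul_cpow_of_eq_cpow_ideleNorm {ω : HeckeCharacter K} {z : ℂ}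
    (hz : ∀ x : ideleGroup K, (ω x : ℂ) = (ideleNorm x : ℂ) ^ z)
    (v : HeightOneSpectrum (𝓞 K)) (s : ℂ) :
    ω.valueAtUniformizer v * (v.residueCard : ℂ) ^ (-s) = (v.residueCard : ℂ) ^ (-(s + z)) := by
  have hq0 : (v.residueCard : ℂ) ≠ 0 := by
    exact_mod_cast (Nat.zero_lt_of_lt v.one_lt_residueCard).ne'
  rw [valueAtUniformizer_of_eq_cpow_ideleNorm hz, ← Complex.cpow_neg, ← Complex.cpow_add _ _ hq0]
  congr 1
  ring

/-- For a norm twist `ω = ‖·‖^z` the finite twisted `L`-function is a translate: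
`L(s, σ ⊗ ‖·‖^z) = L(σ, s + z)` (as `tprod`s, factor by factor). [cite: TateThesis1967, §4.3] -/
theorem artinTwistLFunction_of_eq_cpow_ideleNorm {V : Type*} [AddCommGroup V] [Module ℂ V]
    [TopologicalSpace V] [FiniteDimensional ℂ V] (σ : ArtinRep K V) {ω : HeckeCharacter K}
    {z : ℂ} (hz : ∀ x : ideleGroup K, (ω x : ℂ) = (ideleNorm x : ℂ) ^ z) (s : ℂ) :
    artinTwistLFunction σ ω s = artinLFunction σ (s + z) := by
  unfold artinTwistLFunction artinLFunction
  exact tprod_congr fun v => by rw [valueAtUniformizer_mul_cpow_of_eq_cpow_ideleNorm hz]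

end NormTwist

/-! ### Ideles of `ℚ`: the idèle class characters unramified everywhere are the `‖·‖^z` -/

section RatIdeles

/-- For an idele `u` of `ℚ` with `u_∞ > 0` and unit finite components, `‖u‖_𝔸 = u_∞`.
Neukirch, *Algebraic Number Theory*, Ch. VI §1 (the norm on `ℝ_{>0} × ∏_p ℤ_pˣ`). [folklore] -/
theorem ideleNorm_eq_infReal_of_units_rat (u : ideleGroup ℚ) (hpos : 0 < Rat.infReal u)
    (hu : ∀ v : HeightOneSpectrum (𝓞 ℚ), Valued.v ((u : AdeleRing (𝓞 ℚ) ℚ).2 v) = 1) :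
    ideleNorm u = Rat.infReal u := by
  unfold ideleNorm
  rw [finprod_eq_one_of_forall_eq_one fun v => by
      rw [FinitePlace.norm_def, hu v, map_one, NNReal.coe_one],
    mul_one, Fintype.prod_subsingleton _ Rat.infinitePlace,
    mult_isReal ⟨Rat.infinitePlace, Rat.isReal_infinitePlace⟩, pow_one, ← abs_of_pos hpos,
    ← Real.norm_eq_abs, Rat.infReal_apply]
  exact ((AddMonoidHomClass.isometry_iff_norm _).1
    (Completion.isometry_extensionEmbeddingOfIsReal (Rat.isReal_infinitePlace' _)) _).symm

/-- The idele norm of the idele supported at the real place of `ℚ` with component `a` is `|a|`.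
[folklore] -/
theorem ideleNorm_infiniteIdeleSingle_rat (a : (Rat.infinitePlace.Completion)ˣ) :
    ideleNorm (infiniteIdeleSingle Rat.infinitePlace a) = ‖(a : Rat.infinitePlace.Completion)‖ := by
  unfold ideleNorm
  rw [finprod_eq_one_of_forall_eq_one fun v => by
      rw [infiniteIdeleSingle_snd]; exact norm_one,
    mul_one, Fintype.prod_subsingleton _ Rat.infinitePlace,
    mult_isReal ⟨Rat.infinitePlace, Rat.isReal_infinitePlace⟩, pow_one, infiniteIdeleSingle_fst_self]

/-- **Every idèle class character of `ℚ` unramified at all finite places is a norm twist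
`‖·‖^z`.** Proof: `𝕀_ℚ = ℚˣ · (ℝ_{>0} × ∏_p ℤ_pˣ)` (Neukirch, Ch. VI §1, Prop. (1.10); the
tree's `Rat.unitIdele`): `ω` kills `ℚˣ`, kills the ideles `(1, (u_p)_p)` with unit components
because it is unramified everywhere (`HeckeCharacter.eq_one_of_isUnramifiedAt_of_units`, a
closure argument), and on the ideles `(r, 1)`, `r > 0`, it is the continuous quasi-character
`r ↦ r^z` of `ℝ_{>0}` (`exists_cpow_of_continuous_isReal`), while `‖(r, u)‖_𝔸 = r`. This is the
remark of Booker–Krishnamurthy 2011, p. 671 ("there are no non-trivial unramified idèle class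
characters over `ℚ`", i.e. none besides the `‖·‖^z`). [cite: BookerKrishnamurthy2011, p. 671] -/
theorem _root_.Literature.NumberTheory.GaloisRepresentations.HeckeCharacter.isNormTwist_of_forall_isUnramifiedAt_rat
    (ω : HeckeCharacter ℚ) (hω : ∀ v : HeightOneSpectrum (𝓞 ℚ), ω.IsUnramifiedAt v) :
    ω.IsNormTwist := by
  obtain ⟨ν, hν⟩ := exists_cpow_of_continuous_isReal Rat.isReal_infinitePlace
    (ω.continuous_archComponent Rat.infinitePlace)
  refine ⟨ν, fun x => ?_⟩
  set u : ideleGroup ℚ := Rat.unitIdele x with hu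
  have hxu : ω x = ω u := by
    rw [hu, Rat.unitIdele_apply, map_mul, map_inv,
      ω.map_principal (GaloisRepresentations.principalIdele_mem _), inv_one, mul_one]
  have hnorm : ideleNorm x = ideleNorm u := by
    rw [← coe_ideleNorm, ← coe_ideleNorm, hu, Rat.unitIdele_apply, map_mul, map_inv,
      ideleNorm_principal (GaloisRepresentations.principalIdele_mem _), inv_one, mul_one]
  have hpos : 0 < Rat.infReal u := Rat.infReal_unitIdele_pos x
  have hunit : ∀ v : HeightOneSpectrum (𝓞 ℚ), Valued.v ((u : AdeleRing (𝓞 ℚ) ℚ).2 v) = 1 :=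
    fun v => Rat.valued_unitIdele v x
  -- the archimedean component `a = u_∞` and the finite-unit idele `z = (1, u_f)`
  have ha0 : (u : AdeleRing (𝓞 ℚ) ℚ).1 Rat.infinitePlace ≠ 0 := fun h0 => by
    have : Rat.infReal u = 0 := by rw [Rat.infReal_apply, h0, map_zero]
    exact hpos.ne' this
  set a : (Rat.infinitePlace.Completion)ˣ := Units.mk0 _ ha0 with ha
  set z : ideleGroup ℚ := (infiniteIdeleSingle Rat.infinitePlace a)⁻¹ * u with hz
  have hz1 : (z : AdeleRing (𝓞 ℚ) ℚ).1 = 1 := by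
    funext w
    obtain rfl : w = Rat.infinitePlace := Subsingleton.elim _ _
    have h1 : (z : AdeleRing (𝓞 ℚ) ℚ).1 Rat.infinitePlace =
        ((infiniteIdeleSingle Rat.infinitePlace a⁻¹ : ideleGroup ℚ) : AdeleRing (𝓞 ℚ) ℚ).1
            Rat.infinitePlace * (u : AdeleRing (𝓞 ℚ) ℚ).1 Rat.infinitePlace := by
      rw [hz, ← map_inv]
      rfl
    rw [h1, infiniteIdeleSingle_fst_self, Units.val_inv_eq_inv_val, ha, Units.val_mk0,
      inv_mul_cancel₀ ha0]
    rfl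
  have hz2 : ∀ v : HeightOneSpectrum (𝓞 ℚ),
      (z : AdeleRing (𝓞 ℚ) ℚ).2 v = (u : AdeleRing (𝓞 ℚ) ℚ).2 v := fun v => by
    rw [hz, ← map_inv, ideleGroup_val_snd_mul, infiniteIdeleSingle_snd]
    exact one_mul _
  have hωz : ω z = 1 :=
    HeckeCharacter.eq_one_of_isUnramifiedAt_of_units (S := (∅ : Set (HeightOneSpectrum (𝓞 ℚ))))
      (fun v _ => hω v) z hz1 (fun v hv => by simp at hv) fun v => by rw [hz2]; exact hunit v
  have hu_eq : u = infiniteIdeleSingle Rat.infinitePlace a * z := by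
    rw [hz, mul_inv_cancel_left]
  have hιa : Completion.extensionEmbeddingOfIsReal Rat.isReal_infinitePlace
      (a : Rat.infinitePlace.Completion) = Rat.infReal u := by
    rw [ha, Units.val_mk0, Rat.infReal_apply]
    rfl
  have hωu : (ω u : ℂ) = (Rat.infReal u : ℂ) ^ ν := by
    have hsplit : (ω u : ℂ) = ω (infiniteIdeleSingle Rat.infinitePlace a) * ω z := by
      rw [hu_eq, map_mul, Units.val_mul]
    rw [hsplit, hωz, Units.val_one, mul_one, ← HeckeCharacter.archComponent_apply]
    exact hν a (Rat.infReal u) hpos hιa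
  rw [hxu, hωu, hnorm, ideleNorm_eq_infReal_of_units_rat u hpos hunit]

/-- **A unitary idèle class character of `ℚ` unramified at all finite places is `‖·‖_𝔸^{it}`
for a real `t`** (`isNormTwist_of_forall_isUnramifiedAt_rat` with Tate §4.3, "a quasi-character
is a character iff its exponent is `0`": `IsUnitary.exists_eq_cpow_mul_I`). These are the
twists occurring in the hypothesis of `bookerKrishnamurthy_isPiOfArtinRep_of_entire_twists` over
`F = ℚ`. [cite: BookerKrishnamurthy2011, p. 671] -/
theorem _root_.Literature.NumberTheory.GaloisRepresentations.HeckeCharacter.exists_eq_cpow_mul_I_of_forall_isUnramifiedAt_rat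
    {ω : HeckeCharacter ℚ} (hu : ω.IsUnitary)
    (hω : ∀ v : HeightOneSpectrum (𝓞 ℚ), ω.IsUnramifiedAt v) :
    ∃ t : ℝ, ∀ x : ideleGroup ℚ, (ω x : ℂ) = (ideleNorm x : ℂ) ^ ((t : ℂ) * I) :=
  hu.exists_eq_cpow_mul_I (ω.isNormTwist_of_forall_isUnramifiedAt_rat hω)

end RatIdeles

/-! ### `Λ(s, σ ⊗ ‖·‖^{it}) = Λ(s + it, σ)` over `ℚ` -/

section Translate

variable {V : Type*} [AddCommGroup V] [Module ℂ V] [TopologicalSpace V] [FiniteDimensional ℂ V]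

/-- The archimedean component of a norm twist `‖·‖^z` of `ℚ` has Booker–Krishnamurthy parameters
`(ν, ε) = (z, 0)` at the real place: `ω_∞(a) = |a|^z`. [cite: BookerKrishnamurthy2011, §1.1 (p. 672)] -/
theorem hasRealParam_of_eq_cpow_ideleNorm_rat {ω : HeckeCharacter ℚ} {z : ℂ}
    (hz : ∀ x : ideleGroup ℚ, (ω x : ℂ) = (ideleNorm x : ℂ) ^ z) :
    HasRealParam Rat.isReal_infinitePlace (ω.archComponent Rat.infinitePlace) z 0 := fun a => by
  rw [HeckeCharacter.archComponent_apply, hz, ideleNorm_infiniteIdeleSingle_rat]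
  simp

omit [FiniteDimensional ℂ V] in
/-- Over `ℚ` (one real place, no complex place) the twisted archimedean factor with parameters
`(ν, ε) = (z, 0)` is the translate `γ(σ, s + z)` of the Artin `Γ`-factor.
[cite: BookerKrishnamurthy2011, §4.2.1 (p. 683)] -/
theorem artinTwistGammaFactor_eq_gammaFactor_add_rat (σ : ArtinRep ℚ V) {P : ArchParams ℚ}
    {z : ℂ} (hν : P.ν Rat.infinitePlace = z) (hε : P.ε Rat.infinitePlace = 0) (s : ℂ) :
    artinTwistGammaFactor σ P s = σ.gammaFactor (s + z) := by
  unfold artinTwistGammaFactor ArtinRep.gammaFactor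
  rw [Fintype.prod_subsingleton _ Rat.infinitePlace, Fintype.prod_subsingleton _ Rat.infinitePlace,
    dif_pos Rat.isReal_infinitePlace, dif_pos Rat.isReal_infinitePlace, hν, hε]
  simp [archLFactorReal]

/-- **`Λ(s, σ ⊗ ‖·‖^{it}) = Λ₀(s + it)` over `ℚ`**, `Λ₀(s) = γ(σ, s) L(σ, s)`: for an idèle class
character `ω = ‖·‖_𝔸^{it}` of `ℚ` and ANY family `P` of archimedean parameters of `ω` (they are
`(it, 0)` at the real place by uniqueness, `HasRealParam.unique`), the complete twisted
`L`-function of the named fact is the translate by `it` of the complete Artin `L`-function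
(without conductor power). [cite: BookerKrishnamurthy2011, Thm. 1.1 (p. 670)] -/
theorem artinTwistCompletedL_eq_comp_add_rat (σ : ArtinRep ℚ V) {ω : HeckeCharacter ℚ} {t : ℝ}
    (hω : ∀ x : ideleGroup ℚ, (ω x : ℂ) = (ideleNorm x : ℂ) ^ ((t : ℂ) * I)) {P : ArchParams ℚ}
    (hP : ω.HasArchParams P) :
    artinTwistCompletedL σ P ω =
      fun s => σ.gammaFactor (s + t * I) * artinLFunction σ (s + t * I) := by
  obtain ⟨hν, hε⟩ := ((hP Rat.infinitePlace).1 Rat.isReal_infinitePlace).unique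
    (hasRealParam_of_eq_cpow_ideleNorm_rat hω)
  funext s
  rw [artinTwistCompletedL, artinTwistGammaFactor_eq_gammaFactor_add_rat σ hν hε,
    artinTwistLFunction_of_eq_cpow_ideleNorm σ hω]

/-- Entire continuation is stable under imaginary translation of the variable (the half-plane
`re s > 1` is preserved). [folklore] -/
theorem _root_.Literature.NumberTheory.GaloisRepresentations.LFunction.HasEntireContinuation.comp_add_of_re_eq_zero
    {f : ℂ → ℂ} (h : LFunction.HasEntireContinuation f) {c : ℂ} (hc : c.re = 0) :
    LFunction.HasEntireContinuation fun s => f (s + c) := by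
  obtain ⟨g, hg, hgf⟩ := h
  refine ⟨fun s => g (s + c), hg.comp (differentiable_id.add_const c), fun s hs => hgf _ ?_⟩
  simp only [Complex.add_re, hc, add_zero]
  exact hs

end Translate

/-! ### The conductor power does not affect entire continuation -/

section ConductorPower

variable {K : Type u} [Field K] [NumberField K] {V : Type*} [AddCommGroup V] [Module ℂ V]
  [TopologicalSpace V] [FiniteDimensional ℂ V]

/-- **`Λ(ρ, s) = A(ρ)^{s/2} γ(ρ, s) L(ρ, s)` is entire iff `γ(ρ, s) L(ρ, s)` is**: the conductor
power `A(ρ)^{s/2} = exp((s/2) log A(ρ))` is entire and nowhere zero since `A(ρ) ≠ 0`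
(`ArtinRep.artinConductorNorm_ne_zero'`). So the hypothesis "`Λ(s, ρ ⊗ ω)` entire" of
Booker–Krishnamurthy may be read with or without the exponential factor (op. cit. Thm. 1.1 puts
none into `Λ`; the conductor enters `ε(s, π ⊗ ω)`). Neukirch, *Algebraic Number Theory*, Ch. VII
§12, (12.2) (`A(ρ)`, `Λ`). [cite: NeukirchANT1999, Ch. VII §12, (12.2)] -/
theorem _root_.Literature.NumberTheory.GaloisRepresentations.LFunction.hasEntireContinuation_completedArtinLFunction_iff
    (ρ : ArtinRep K V) :
    LFunction.HasEntireContinuation (completedArtinLFunction ρ) ↔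
      LFunction.HasEntireContinuation fun s => ρ.gammaFactor s * artinLFunction ρ s := by
  have hA : (ρ.artinConductorNorm : ℂ) ≠ 0 := Nat.cast_ne_zero.2 ρ.artinConductorNorm_ne_zero'
  -- `E(s) = A^{s/2}` is entire and nowhere zero
  set E : ℂ → ℂ := fun s => (ρ.artinConductorNorm : ℂ) ^ (s / 2) with hEdef
  have hE : Differentiable ℂ E := fun s =>
    DifferentiableAt.const_cpow (differentiableAt_id.div_const 2) (Or.inl hA)
  have hE0 : ∀ s, E s ≠ 0 := fun s => Complex.cpow_ne_zero_iff.mpr (Or.inl hA)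
  have hΛ : ∀ s, completedArtinLFunction ρ s = E s * (ρ.gammaFactor s * artinLFunction ρ s) :=
    fun s => by rw [completedArtinLFunction, mul_assoc]
  constructor
  · rintro ⟨g, hg, hgf⟩
    refine ⟨fun s => (E s)⁻¹ * g s, (hE.inv hE0).mul hg, fun s hs => ?_⟩
    simp only [hgf s hs, hΛ s, ← mul_assoc, inv_mul_cancel₀ (hE0 s), one_mul]
  · rintro ⟨g, hg, hgf⟩
    refine ⟨fun s => E s * g s, hE.mul hg, fun s hs => ?_⟩
    simp only [hgf s hs, hΛ s]

end ConductorPower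

/-! ### The hypothesis of the named fact over `ℚ`, and the `F = ℚ` instance of the fact -/

section Rat

variable {V : Type*} [AddCommGroup V] [Module ℂ V] [TopologicalSpace V] [FiniteDimensional ℂ V]

/-- **Over `ℚ` the Booker–Krishnamurthy hypothesis is "`Λ(s, σ)` is entire".** For an Artin
representation `σ` of `ℚ`, the hypothesis of `bookerKrishnamurthy_isPiOfArtinRep_of_entire_twists`
— `Λ(s, σ ⊗ ω)` has an entire continuation for every unitary idèle class character `ω`
unramified at all finite places and every parameter family of `ω` — holds if and only if
`Λ₀(s) = γ(σ, s) L(σ, s)` has an entire continuation: `⇒` is the instance `ω = 1`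
(`artinTwistCompletedL_zero_one`); `⇐` because such `ω` are the `‖·‖_𝔸^{it}`
(`HeckeCharacter.exists_eq_cpow_mul_I_of_forall_isUnramifiedAt_rat`), for which
`Λ(s, σ ⊗ ω) = Λ₀(s + it)` (`artinTwistCompletedL_eq_comp_add_rat`). This is the content of the
remark of op. cit. p. 671 that over `ℚ` analytic properties of the single `L`-function `Λ(s, σ)`
suffice (Booker 2003). [cite: BookerKrishnamurthy2011, p. 671] -/
theorem bookerKrishnamurthy_hypothesis_iff_rat (σ : ArtinRep ℚ V) :
    (∀ ω : HeckeCharacter ℚ, ω.IsUnitary →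
        (∀ v : HeightOneSpectrum (𝓞 ℚ), ω.IsUnramifiedAt v) →
        ∀ P : ArchParams ℚ, ω.HasArchParams P →
          LFunction.HasEntireContinuation (artinTwistCompletedL σ P ω)) ↔
      LFunction.HasEntireContinuation fun s => σ.gammaFactor s * artinLFunction σ s := by
  constructor
  · intro h
    have h1 := h 1 HeckeCharacter.isUnitary_one HeckeCharacter.isUnramifiedAt_one 0
      HeckeCharacter.hasArchParams_one
    rwa [artinTwistCompletedL_zero_one] at h1
  · intro hΛ ω hu hur P hP
    obtain ⟨t, ht⟩ := HeckeCharacter.exists_eq_cpow_mul_I_of_forall_isUnramifiedAt_rat hu hur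
    rw [artinTwistCompletedL_eq_comp_add_rat σ ht hP]
    exact hΛ.comp_add_of_re_eq_zero (by simp)

/-- **Booker–Krishnamurthy 2011, Cor. 1.2, over `F = ℚ`** (as a consequence of the named fact
`bookerKrishnamurthy_isPiOfArtinRep_of_entire_twists`, via `bookerKrishnamurthy_hypothesis_iff_rat`):
**if the complete Artin `L`-function `Λ(s, σ) = γ(σ, s) L(σ, s)` of a two-dimensional Galois
representation `σ : Γ_ℚ → GL₂(ℂ)` has an entire continuation, then `σ` is automorphic** — there is
an automorphic representation `π` of `GL₂(𝔸_ℚ)` with `π = π(σ)` in the almost-everywhere sense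
`IsPiOfArtinRep σ π` —, for every `σ` (either parity; `σ` not assumed irreducible; `π` not
asserted cuspidal, op. cit. Remark (i)). Over `ℚ` the unramified twists are the `‖·‖^{it}`
(op. cit. p. 671), so "one recovers [the strong Artin conjecture from Artin's conjecture for the
single `L`-function `Λ(s, σ)`]" as in Booker 2003 (Ann. of Math. 158, Corollary p. 1090; vendored
separately, for irreducible `σ` and the finite `L`-function, as
`booker_strongArtin_of_artinConjecture`). [cite: BookerKrishnamurthy2011, Cor. 1.2 (p. 670) and p. 671] -/
theorem bookerKrishnamurthy_isPiOfArtinRep_of_entire_twists.rat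
    (h : bookerKrishnamurthy_isPiOfArtinRep_of_entire_twists) (σ : FramedArtinRep ℚ 2)
    (hΛ : LFunction.HasEntireContinuation
      fun s => σ.toArtinRep.gammaFactor s * artinLFunction σ.toArtinRep s) :
    ∃ (hcpt : isCompact_glFiniteIntegralLevel 2 ℚ)
      (π : AutomorphicRepData (AutomorphyDatum.gl 2 ℚ hcpt)), IsPiOfArtinRep σ π :=
  h ℚ σ ((bookerKrishnamurthy_hypothesis_iff_rat σ.toArtinRep).mpr hΛ)

/-- **Booker–Krishnamurthy 2011, Cor. 1.2, over `F = ℚ`, with the tree's completed Artin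
`L`-function** `Λ(σ, s) = A(σ)^{s/2} γ(σ, s) L(σ, s)` (`completedArtinLFunction`): if `Λ(σ, s)`
has an entire continuation then `σ : Γ_ℚ → GL₂(ℂ)` is automorphic (`IsPiOfArtinRep σ π` for some
automorphic `π` of `GL₂(𝔸_ℚ)`) — `bookerKrishnamurthy_isPiOfArtinRep_of_entire_twists.rat` with
`LFunction.hasEntireContinuation_completedArtinLFunction_iff`.
[cite: BookerKrishnamurthy2011, Cor. 1.2 (p. 670) and p. 671] -/
theorem bookerKrishnamurthy_isPiOfArtinRep_of_entire_twists.rat'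
    (h : bookerKrishnamurthy_isPiOfArtinRep_of_entire_twists) (σ : FramedArtinRep ℚ 2)
    (hΛ : LFunction.HasEntireContinuation (completedArtinLFunction σ.toArtinRep)) :
    ∃ (hcpt : isCompact_glFiniteIntegralLevel 2 ℚ)
      (π : AutomorphicRepData (AutomorphyDatum.gl 2 ℚ hcpt)), IsPiOfArtinRep σ π :=
  h.rat σ ((LFunction.hasEntireContinuation_completedArtinLFunction_iff σ.toArtinRep).mp hΛ)

end Rat

end Literature.NumberTheory.Automorphic

end
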